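import Summits.BirchSwinnertonDyer.BirchSwinnertonDyer.Theorems.RamifiedHeegnerPairLeafRankOneUpperAtThreeOfSigma
import Summits.BirchSwinnertonDyer.BirchSwinnertonDyer.Theorems.RamifiedHeegnerPairLeafRankZeroUpperAtThreeSocket
import HarnessLib

/-!
# Route `RamifiedHeegnerPair` (rev 7) — CAPSTONE of the two upper-member lines: the W-ALL leaf Gss2 at `3` from the two LOWER members
# (L₁ = 26021, L₀ = 26023), ONE orientation-free research statement Σ★ (Σ-form global `3`-divisibility of derived Heegner points at
# the additive `3` on the leaf) and PRINT

HONEST FRAMING. Theorems only; helper file (`--supports stmt-BirchSwinnertonDyer-26022 --as helper`); nothing is booked, no item is closed,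
BSD is not proved for any curve; CONDITIONAL on every displayed input (audit `proof.conditional`). The route's `closes` is
`(hP : PublishedInputGZK) (hL1 : Gss2LowerAtThreeRankOne) (hU1 : LeafRankOneUpperAtThree) (hL0 : Gss2LowerAtThreeRankZero)
(hU0 : LeafRankZeroUpperAtThree) : WAllExclAddGssAtThree`. The lead's two registered lines cut the UPPER members as
U₁ ⟸ PUB + Σ + L₀ (p610955) and U₀ ⟸ PUB₀ + Σ₀ + L₁ + L₀ (p611715). Here:

* `sigma_of_sigmaStar`, `sigmaZero_of_sigmaStar` — both registered research stubs (`stub_leafSigmaDivisibilityAtThree` on 26022,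
  `stub_leafSigmaDivisibilityAtThreeRankZero` on 26024) follow from ONE orientation-free statement Σ★ (drop the analytic-rank and `L`-value
  binders, keep «`P` non-torsion»; by Gross–Zagier that is `ord_{s=1} L(E/K,s) = 1` in either orientation) — trivially, by weakening.
* `wAllExclAddGssAtThree_of_lowerMembers_of_sigmaStar` — **the leaf `WAllExclAddGssAtThree` ⟸ PUB★ + Σ★ + L₁ + L₀**: the route's `closes`
  with both upper binders discharged by the two compositions. So, for the route as re-keyed, the Euler-system side costs exactly ONE research
  statement beyond print, and the deciding content is the two LOWER members (L₁ attacked by rhp-p1; L₀ residual) — numbers, not adjectives: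
  Σ★ is vacuous on the Tamagawa–Manin-clean rows (9 of 355 r1 classes; every t₃ = 0 r0 class with a `3 ∤ c` datum), max-form on 108 r1 classes,
  Σ-form proper on 238 (`Cruxes/LeafRankOneUpperAtThree/SIGMA-STATUS.md`).

Lead prover bsd-line-rhp-p2 g3, 2026-08-28. References: [cite: Jetchev2008, Conj. 1.3 (p. 812)] [cite: MatarNekovar2019, Thm. 0.7 (p. 456)]
[cite: GrossZagier1986, Thm. I.(6.3)] [cite: Miller2011LMS, §1 and Def. 1.1].
-/

-- D-0017: single-problem summit, so `Summit.BirchSwinnertonDyer.BirchSwinnertonDyer.…` repeats a namespace BY DESIGN.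
set_option linter.dupNamespace false
set_option autoImplicit false

noncomputable section

open scoped Classical NumberField

open WeierstrassCurve Literature Literature.NumberTheory.EllipticCurves
  Literature.NumberTheory.EllipticCurves.ModularForms
  Literature.NumberTheory.EllipticCurves.Rank1Residual
  Summit.BirchSwinnertonDyer.Rank1Residual.Additive
  Summit.BirchSwinnertonDyer.Rank1Residual.X11b.Three
  Summit.BirchSwinnertonDyer.BirchSwinnertonDyer.Theses.RamifiedHeegnerPair
  Summit.BirchSwinnertonDyer.BirchSwinnertonDyer.Theorems

namespace Summit.BirchSwinnertonDyer.BirchSwinnertonDyer.Theorems.RamifiedPairUpperBound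

/-- **Σ★ — the orientation-free Σ-form global `3`-divisibility of derived Heegner points at the additive `3` on the leaf** (a predicate-valued
abbreviation for the hypothesis shape only; NOT a definition of the tree's vocabulary — stated inline as the hypothesis of the theorems below).
For `W` globally minimal, non-CM, `Addv W 3`, `SubGss W 3`, conductor `N`; `K` imaginary quadratic of odd discriminant, Heegner for `N`; `Dt`, `H`, `ι`,
`P` with `ι(P)` the complex Heegner point and `P` NON-TORSION: every derived point on the frame `(Dt, H.β, ι)` at square-free Kolyvagin level `n`
(primes of index `≥ s′`) is `3^{s′}`-divisible for all `s′ ≤ ord₃ ∏c_ℓ(W) + v₃(c)`. [cite: Jetchev2008, Conj. 1.3 (p. 812)] -/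
theorem sigma_of_sigmaStar
    (hStar : ∀ (W : WeierstrassCurve ℚ) [W.IsElliptic] [W.IsGloballyMinimal] (N : ℕ) [NeZero N]
      (K : Type) [Field K] [NumberField K] (Dt : ModularParametrizationData W N)
      (H : HeegnerDatum N (NumberField.discr K)) (ι : K →+* ℂ) (P : (W.baseChange K).toAffine.Point),
      ¬ W.HasCM → Addv W 3 → SubGss W 3 → W.conductorNorm ℤ = N → IsImaginaryQuadratic K →
      SatisfiesHeegnerHypothesis N K →
      (WeierstrassCurve.Affine.Point.map ι.toRatAlgHom) P = heegnerPointComplex Dt H → ¬ IsOfFinAddOrder P →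
      Odd (NumberField.discr K) →
      ∀ (s' : ℕ), s' ≤ padicValNat 3 W.tamagawaProduct + padicValNat 3 Dt.c.natAbs →
      ∀ (n : ℕ) (d : KolyvaginHeegnerData Dt H.β ι n), Squarefree n →
      (∀ ℓ ∈ n.primeFactors, Zhang2014.IsKolyvaginPrime N W K 3 ℓ ∧ s' ≤ Zhang2014.kolyvaginIndex W 3 ℓ) → Koly.PDiv d 3 s') :
    ∀ (W : WeierstrassCurve ℚ) [W.IsElliptic] [W.IsGloballyMinimal] (N : ℕ) [NeZero N]
      (K : Type) [Field K] [NumberField K] (Dt : ModularParametrizationData W N)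
      (H : HeegnerDatum N (NumberField.discr K)) (ι : K →+* ℂ) (P : (W.baseChange K).toAffine.Point),
      ¬ W.HasCM → Addv W 3 → SubGss W 3 → W.analyticRank = 1 → W.conductorNorm ℤ = N → IsImaginaryQuadratic K →
      SatisfiesHeegnerHypothesis N K → (W.quadraticTwist (NumberField.discr K : ℚ)).entireLFunction 1 ≠ 0 →
      (WeierstrassCurve.Affine.Point.map ι.toRatAlgHom) P = heegnerPointComplex Dt H → ¬ IsOfFinAddOrder P →
      Odd (NumberField.discr K) →
      ∀ (s' : ℕ), s' ≤ padicValNat 3 W.tamagawaProduct + padicValNat 3 Dt.c.natAbs →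
      ∀ (n : ℕ) (d : KolyvaginHeegnerData Dt H.β ι n), Squarefree n →
      (∀ ℓ ∈ n.primeFactors, Zhang2014.IsKolyvaginPrime N W K 3 ℓ ∧ s' ≤ Zhang2014.kolyvaginIndex W 3 ℓ) → Koly.PDiv d 3 s' :=
  fun W _ _ N _ K _ _ Dt H ι P hCM hadd hsub _ hN hK hHN _ hP hnt hodd s' hs' n d hn hℓ ↦
    hStar W N K Dt H ι P hCM hadd hsub hN hK hHN hP hnt hodd s' hs' n d hn hℓ

/-- Σ★ ⟹ Σ₀ (the rank-zero orientation stub of line `splitkolyvagin0` on 26024), by weakening. [cite: Jetchev2008, Conj. 1.3 (p. 812)] -/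
theorem sigmaZero_of_sigmaStar
    (hStar : ∀ (W : WeierstrassCurve ℚ) [W.IsElliptic] [W.IsGloballyMinimal] (N : ℕ) [NeZero N]
      (K : Type) [Field K] [NumberField K] (Dt : ModularParametrizationData W N)
      (H : HeegnerDatum N (NumberField.discr K)) (ι : K →+* ℂ) (P : (W.baseChange K).toAffine.Point),
      ¬ W.HasCM → Addv W 3 → SubGss W 3 → W.conductorNorm ℤ = N → IsImaginaryQuadratic K →
      SatisfiesHeegnerHypothesis N K →
      (WeierstrassCurve.Affine.Point.map ι.toRatAlgHom) P = heegnerPointComplex Dt H → ¬ IsOfFinAddOrder P →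
      Odd (NumberField.discr K) →
      ∀ (s' : ℕ), s' ≤ padicValNat 3 W.tamagawaProduct + padicValNat 3 Dt.c.natAbs →
      ∀ (n : ℕ) (d : KolyvaginHeegnerData Dt H.β ι n), Squarefree n →
      (∀ ℓ ∈ n.primeFactors, Zhang2014.IsKolyvaginPrime N W K 3 ℓ ∧ s' ≤ Zhang2014.kolyvaginIndex W 3 ℓ) → Koly.PDiv d 3 s') :
    ∀ (W : WeierstrassCurve ℚ) [W.IsElliptic] [W.IsGloballyMinimal] (N : ℕ) [NeZero N]
      (K : Type) [Field K] [NumberField K] (Dt : ModularParametrizationData W N)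
      (H : HeegnerDatum N (NumberField.discr K)) (ι : K →+* ℂ) (P : (W.baseChange K).toAffine.Point),
      ¬ W.HasCM → Addv W 3 → SubGss W 3 → W.analyticRank = 0 → W.conductorNorm ℤ = N → IsImaginaryQuadratic K →
      SatisfiesHeegnerHypothesis N K → (W.quadraticTwist (NumberField.discr K : ℚ)).entireLFunction 1 = 0 →
      deriv (W.quadraticTwist (NumberField.discr K : ℚ)).entireLFunction 1 ≠ 0 →
      (WeierstrassCurve.Affine.Point.map ι.toRatAlgHom) P = heegnerPointComplex Dt H → ¬ IsOfFinAddOrder P →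
      Odd (NumberField.discr K) →
      ∀ (s' : ℕ), s' ≤ padicValNat 3 W.tamagawaProduct + padicValNat 3 Dt.c.natAbs →
      ∀ (n : ℕ) (d : KolyvaginHeegnerData Dt H.β ι n), Squarefree n →
      (∀ ℓ ∈ n.primeFactors, Zhang2014.IsKolyvaginPrime N W K 3 ℓ ∧ s' ≤ Zhang2014.kolyvaginIndex W 3 ℓ) → Koly.PDiv d 3 s' :=
  fun W _ _ N _ K _ _ Dt H ι P hCM hadd hsub _ hN hK hHN _ _ hP hnt hodd s' hs' n d hn hℓ ↦
    hStar W N K Dt H ι P hCM hadd hsub hN hK hHN hP hnt hodd s' hs' n d hn hℓ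

/-- **CAPSTONE: the W-ALL leaf Gss2 at `3` from the two LOWER members, Σ★ and print.** `WAllExclAddGssAtThree` (BSD₃ for every non-CM
`(G) ∧ ss`-at-`3` curve of analytic rank `≤ 1`) ⟸ PUB★ (Gross–Zagier, Kolyvagin, GZK, modularity L, GZ I.(7.3), Matar–Nekovář Thm. 0.7, newform,
Friedberg–Hoffstein split-divisors, Bump–Friedberg–Hoffstein (i), parametrisation datum — named facts) + Σ★ + L₁ (`Gss2LowerAtThreeRankOne`,
item 26021) + L₀ (`Gss2LowerAtThreeRankZero`, item 26023): the route's `closes` with `hU1 := leafRankOneUpperAtThree_of_pub_of_sigma_of_lowerRankZero`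
(p610955) and `hU0 := leafRankZeroUpperAtThree_of_pub_of_sigma_of_lowerRankOne_of_lowerRankZero` (p611715). CONDITIONAL (conditional-result);
credits nothing; BSD is not proved. [cite: Jetchev2008, Conj. 1.3 (p. 812)] [cite: MatarNekovar2019, Thm. 0.7 (p. 456)]
[cite: GrossZagier1986, Thm. I.(6.3)] [cite: Miller2011LMS, §1 and Def. 1.1] -/
theorem wAllExclAddGssAtThree_of_lowerMembers_of_sigmaStar
    (hpub : (∀ (N : ℕ) [NeZero N] (W : WeierstrassCurve ℚ) (K : Type) [Field K] [NumberField K], gross_zagier N W K) ∧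
      (∀ (N : ℕ) [NeZero N] (W : WeierstrassCurve ℚ) (K : Type) [Field K] [NumberField K], kolyvagin N W K) ∧
      rank_eq_analyticRank_of_analyticRank_le_one ∧ WeierstrassCurve.hasEntireLFunction_rat ∧ GrossZagier1986_thm_I_7_3 ∧
      MatarNekovar2019.thm07_padicValNat_card_sha_primary_add_le_of_globalDivisibility_of_irreducible ∧ exists_isNewformOf ∧
      friedbergHoffstein_exists_heegnerField_splitDivisors_twist_ne_zero ∧
      bumpFriedbergHoffstein_exists_heegnerField_split_twist_simpleZero ∧ nonempty_modularParametrizationData)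
    (hStar : ∀ (W : WeierstrassCurve ℚ) [W.IsElliptic] [W.IsGloballyMinimal] (N : ℕ) [NeZero N]
      (K : Type) [Field K] [NumberField K] (Dt : ModularParametrizationData W N)
      (H : HeegnerDatum N (NumberField.discr K)) (ι : K →+* ℂ) (P : (W.baseChange K).toAffine.Point),
      ¬ W.HasCM → Addv W 3 → SubGss W 3 → W.conductorNorm ℤ = N → IsImaginaryQuadratic K →
      SatisfiesHeegnerHypothesis N K →
      (WeierstrassCurve.Affine.Point.map ι.toRatAlgHom) P = heegnerPointComplex Dt H → ¬ IsOfFinAddOrder P →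
      Odd (NumberField.discr K) →
      ∀ (s' : ℕ), s' ≤ padicValNat 3 W.tamagawaProduct + padicValNat 3 Dt.c.natAbs →
      ∀ (n : ℕ) (d : KolyvaginHeegnerData Dt H.β ι n), Squarefree n →
      (∀ ℓ ∈ n.primeFactors, Zhang2014.IsKolyvaginPrime N W K 3 ℓ ∧ s' ≤ Zhang2014.kolyvaginIndex W 3 ℓ) → Koly.PDiv d 3 s')
    (hL1 : Gss2LowerAtThreeRankOne) (hL0 : Gss2LowerAtThreeRankZero) :
    Summit.BirchSwinnertonDyer.WAllExclAddGssAtThree := by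
  obtain ⟨hGZ, hKo, hGZK, hmod, hGZ73, hMN, hnf, hFH, hBFH, hMP⟩ := hpub
  exact closes hGZK hL1
    (leafRankOneUpperAtThree_of_pub_of_sigma_of_lowerRankZero ⟨hGZ, hKo, hGZK, hmod, hGZ73, hMN, hnf, hFH, hMP⟩
      (sigma_of_sigmaStar hStar) hL0)
    hL0
    (leafRankZeroUpperAtThree_of_pub_of_sigma_of_lowerRankOne_of_lowerRankZero ⟨hGZ, hKo, hGZK, hmod, hMN, hnf, hBFH, hMP⟩
      (sigmaZero_of_sigmaStar hStar) hL1 hL0)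

end Summit.BirchSwinnertonDyer.BirchSwinnertonDyer.Theorems.RamifiedPairUpperBound

end
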